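import Literature.NumberTheory.QuadraticForms.DiagonalFormIsotropy
import Literature.NumberTheory.Automorphic.QuadraticLocalBaseChange
import Literature.NumberTheory.Automorphic.UnitaryGroupSplitPlace
import Mathlib.NumberTheory.NumberField.CMField
import HarnessLib

/-!
# Hermitian forms of rank ≥ 3 over a quadratic extension are isotropic at every finite place
(Jacobson, *A note on hermitian forms* (1940), §2 Theorem, (7), §3 (1)(a); O'Meara 63:19 / Serre, *A Course in
Arithmetic*, Ch. IV §2.2 Thm. 6 (iv))

Topic `NumberTheory/QuadraticForms`; namespace `Literature.NumberTheory.QuadraticForms` (grouping sub-namespace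
`HermitianLocal`).  KERNEL only: proved theorems, **no definitions, no named facts, no `sorry`**.

**Setting.** `E/F` number fields with an `F`-automorphism `c` of `E`, `v` a finite place of `F`,
`E_v := E ⊗_F F_v = Π_{w ∣ v} E_w` the tree's `UnitaryGroup.LocalRing E v` with its conjugation
`c ⊗ 1 = UnitaryGroup.conjLocal E c v` and structure map `ι_v = UnitaryGroup.toLocalRing E v : F_v →+* E_v`
(`QuadraticLocalBaseChange`), and a diagonal `c`-hermitian form `h = ⟨d₁, …, d_m⟩`, `c dᵢ = dᵢ` (ARBITRARY, zero
coefficients allowed), in `m ≥ 3` variables: `h(x, y) = Σᵢ c(xᵢ) dᵢ yᵢ`.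

**Result.** `h` is ISOTROPIC over `E_v` at EVERY finite place `v` (split or not, dyadic included):
`∃ x ∈ E_v^m, x ≠ 0, Σᵢ (c ⊗ 1)(xᵢ) · dᵢ · xᵢ = 0`.

* §1 `HermitianLocal.exists_isotropic_of_diagIsotropic` — Jacobson's trace-form reduction as pure algebra: for a
  commutative ring `R` with a ring endomorphism `σ`, an injective `ι : K →+* R` from a field (`2 ≠ 0`) fixed by
  `σ`, and a unit `θ ∈ R` with `σ θ = -θ`, `θ² = ι t`, the substitution `xᵢ = ι uᵢ + ι wᵢ · θ` turns a non-trivial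
  zero `(u, w)` of the diagonal QUADRATIC trace form `⟨a₁, …, a_m, -t a₁, …, -t a_m⟩ = ⟨a⟩ ⊗ ⟨1, -t⟩` over `K`
  (Jacobson (7); tree predicate `DiagIsotropic`, O'Meara §42D) into an isotropic vector of the `σ`-hermitian form
  `⟨a₁, …, a_m⟩` over `(R, σ)`; `x ≠ 0` because `ι u + ι w θ = 0 ⟹ u = w = 0` (apply `σ`).
* §2 `HermitianLocal.exists_isotropic_localRing_of_mul_self_eq` — the number-field instance `R = E ⊗_F F_v`,
  `σ = c ⊗ 1`, `ι = ι_v`, `θ = δ ⊗ 1` for any `δ ∈ E` with `c δ = -δ ≠ 0`, `δ² = t ∈ F`, `m ≥ 3`, `a : Fin m → F`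
  arbitrary: the trace form has rank `2m ≥ 6 ≥ 5`, hence is isotropic over `F_v` by **O'Meara 63:19** in the tree
  form `diagIsotropic_adicCompletion_of_five_le` (`DiagonalFormIsotropy.lean`, proved there from Serre IV Thm. 6 (iv)
  = `exists_quinary_zero`, dyadic places included); `c ⊗ 1` fixes `ι_v(F_v)` (`conjLocal_toLocalRing`) and negates
  `δ ⊗ 1` (`conjLocal_algebraMap`).
* §3 the parameter-free forms for a quadratic extension, `[Algebra.IsQuadraticExtension F E]`, `c ≠ 1`, `m ≥ 3`, and
  coefficients `dᵢ ∈ E` with `c dᵢ = dᵢ` (`= F`-rational, private `exists_algebraMap_eq_of_apply_eq_self`):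
  **`HermitianLocal.exists_isotropic_localRing`** (over `E ⊗_F F_v`, every finite `v`), its `Matrix.diagonal` /
  `dotProduct` dresses `exists_isotropic_localRing_diagonal` and `exists_isotropic_localRing_adelicForm` (the latter
  for the matrix `(adelicForm E m (diagonal d)).map (adeleToLocal E v)` that DEFINES the tree's local unitary group
  `UnitaryGroup.«local» … v`), the single-completion forms
  **`HermitianLocal.exists_isotropic_adicCompletion`** / `exists_isotropic_adicCompletion_placeForm` at a NON-SPLIT
  place `w` (`c • w = w`, conjugation `galAdicCompletionMap c hw` of `E_w`, form `UnitaryGroup.placeForm`), and the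
  CM specialisation `HermitianLocal.exists_isotropic_localRing_cm` (`E = L` CM, `F = L⁺`, `c` = complex conjugation,
  `dᵢ ∈ L` with `d̄ᵢ = dᵢ`).

Rank `3` is sharp for non-degenerate forms (binary anisotropic hermitian forms exist at non-split places: the norm
form of the quaternion division algebra over `F_v`).

## Siblings in the tree (other models of the same device — not duplicated, not consumable by name here)

* `Weil1965/HermitianPlaceHypothesis.lean`: `Weil1965.exists_ne_zero_hermitian_isotropic_adicCompletion` — the same
  local statement in the ABSTRACT model `QuadraticAlgebra F_v c 0 = F_v[ω]/(ω² - c)` with coefficients in `F_v` and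
  conjugation `star` (Weil's place hypothesis `U(0)_v ≠ ∅`), also by Jacobson's trace form + O'Meara 63:19.
* `QuadraticForms/LandherrHermitianIsotropy.lean` (+ `LandherrHermitian*`): the GLOBAL theorem over a CM field
  (`hermitianDiagonal_isotropic_iff_indefinite`, Jacobson's trace form + Hasse–Minkowski).
The present file is the version in the `UnitaryGroup.LocalRing E v = E ⊗_F F_v` and `w.adicCompletion E` models
with the conjugations `conjLocal` / `galAdicCompletionMap`, i.e. the rings in which the tree's adelic and local
unitary groups (`Automorphic/UnitaryGroupAutomorphicRep`, `UnitaryGroupLocalFactors`, `GelbartRogawski1991/*`) are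
defined.  Transporting the `QuadraticAlgebra` statement along `QuadraticAlgebra.lift (δ ⊗ 1)` would need the
injectivity of that lift (= the independence of `1, δ ⊗ 1` over `ι_v F_v` proved in §1) and a `star ↦ conjLocal`
compatibility lemma, i.e. more than the fifteen-line device of §1, which is therefore re-proved inline, as in both
siblings.

## Use

Written for the Hodge-CM period-theorem cell (`pub-hodgecm` / `pub-hodgecm2`, 2026-08-22): it DISCHARGES the one
displayed hypothesis `hiso` — "the rank-3 hermitian form `J = diag(d)` is isotropic over `E_w` at every non-split
finite place" — of the planned kernel chain `Automorphic/UnitaryGroupAdelicCharactersDet` (every continuous character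
of `U(J)(𝔸_F)`, `J` hermitian of rank `3`, factors through `det`), in both the `E ⊗_F F_v`-model used by that chain's
field engine (pattern `GelbartRogawski1991/DoubledWeilRepresentationUniqueness` §7, `K = UnitaryGroup.LocalRing`,
`σ = conjLocal`) and the single-completion model.  Nothing in this file is a claim of the manuscripts adjudicated by
that cell.

## Mathlib / tree

Mathlib has no hermitian forms over a field with involution and no local theory of quadratic forms; nothing of
Mathlib is duplicated.  Tree: `QuadraticForms/DiagonalFormIsotropy` (`DiagIsotropic`,
`diagIsotropic_adicCompletion_of_five_le`), `Automorphic/QuadraticLocalBaseChange` (`toLocalRing`,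
`toLocalRing_injective`, `toLocalRing_coe`, `toPlace`, `toPlace_coe`, `conjLocal_toLocalRing`, `conjLocal_algebraMap`,
`galAdicCompletionMap_toPlace`, `not_mem_range_algebraMap_of_apply_eq_neg`, `exists_eq_add_mul_of_isQuadraticExtension`),
`Automorphic/UnitaryGroupSplitPlace` (`algEquiv_mul_self_eq_one`), `Automorphic/GaloisActionPlaces`
(`galAdicCompletionMap`, `galAdicCompletionMap_coe_algEquiv`), `Automorphic/UnitaryGroupAutomorphicRep`
(`UnitaryGroup.LocalRing`, `conjLocal`, `PlacesOver`, `adelicForm`, `adeleToLocal`), `Automorphic/UnitaryGroupLocalFactors`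
(`placeForm`).

## References

* N. Jacobson, *A note on hermitian forms*, Bull. Amer. Math. Soc. 46 (1940) 264–268: §2 Theorem (hermitian forms
  over `Φ₀(i)` are classified by their trace forms), display (7) (the trace form of `⟨β₁, …, βₙ⟩` is
  `⊕ᵢ [βᵢ, λβᵢ]`, `i² = -λ`), §3 (1)(a) (over a `𝔭`-adic `Φ₀` every hermitian form in `≥ 2` variables is universal,
  hence every one in `≥ 3` variables is a null form) [Jacobson1940HermitianForms].
* O. T. O'Meara, *Introduction to Quadratic Forms*, Grundlehren 117 (1963), §63C Prop. 63:19 p. 170 [Omeara1963].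
* J.-P. Serre, *A Course in Arithmetic*, GTM 7 (1973), Ch. IV §2.2 Thm. 6 (iv) [Serre1973].
* W. Scharlau, *Quadratic and Hermitian Forms*, Grundlehren 270 (1985), Ch. 10 §1 [Scharlau1985HermitianForms].
-/

open NumberField IsDedekindDomain
open Literature.NumberTheory.Automorphic

namespace Literature.NumberTheory.QuadraticForms

namespace HermitianLocal

/-! ## §1 Jacobson's trace-form reduction (pure algebra) -/

/-- **Jacobson's reduction, isotropy half.** `R` a commutative ring with an endomorphism `σ`, `ι : K →+* R` an
injective homomorphism from a field with `2 ≠ 0` whose image is fixed by `σ`, `θ ∈ Rˣ` with `σ θ = -θ` and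
`θ² = ι t`.  If the diagonal quadratic TRACE FORM `⟨a₁, …, a_m, -t a₁, …, -t a_m⟩` has a non-trivial zero
`(u, w) ∈ K^{2m}`, then `xᵢ := ι uᵢ + ι wᵢ θ` is a NON-ZERO isotropic vector of the `σ`-hermitian form `⟨a₁, …, a_m⟩`:
`Σᵢ σ(xᵢ) ι(aᵢ) xᵢ = ι(Σᵢ aᵢ(uᵢ² - t wᵢ²)) = 0`. [cite: Jacobson1940HermitianForms, §2 Theorem & (7)] -/
theorem exists_isotropic_of_diagIsotropic {K R : Type*} [Field K] [CommRing R] (ι : K →+* R)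
    (hι : Function.Injective ι) (σ : R →+* R) (hσι : ∀ a, σ (ι a) = ι a) {θ : R} (hσθ : σ θ = -θ)
    (hθ : IsUnit θ) {t : K} (hθt : θ * θ = ι t) (h2 : (2 : K) ≠ 0) {m : ℕ} {a : Fin m → K}
    (h : DiagIsotropic (Fin.append a fun i => -(t * a i))) :
    ∃ x : Fin m → R, x ≠ 0 ∧ ∑ i, σ (x i) * ι (a i) * x i = 0 := by
  -- `1, θ` are independent over `ι K`: apply `σ`
  have hind : ∀ p q : K, ι p + ι q * θ = 0 → p = 0 ∧ q = 0 := by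
    intro p q h
    have h' := congrArg σ h
    rw [map_add, map_mul, map_zero, hσι, hσι, hσθ] at h'
    have hp : ι (2 * p) = 0 := by rw [map_mul, map_ofNat]; linear_combination h + h'
    have hq' : ι (2 * q) * θ = 0 := by rw [map_mul, map_ofNat]; linear_combination h - h'
    rw [hθ.mul_left_eq_zero] at hq'
    rw [map_eq_zero_iff ι hι, mul_eq_zero, or_iff_right h2] at hp hq'
    exact ⟨hp, hq'⟩
  obtain ⟨y, hy, hq⟩ := h
  refine ⟨fun i => ι (y (Fin.castAdd m i)) + ι (y (Fin.natAdd m i)) * θ, fun h0 => hy ?_, ?_⟩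
  · funext k
    induction k using Fin.addCases with
    | left i => simpa using (hind _ _ (by simpa using congrFun h0 i)).1
    | right i => simpa using (hind _ _ (by simpa using congrFun h0 i)).2
  · rw [Fin.sum_univ_add] at hq
    simp only [Fin.append_left, Fin.append_right] at hq
    have hterm : ∀ i, σ (ι (y (Fin.castAdd m i)) + ι (y (Fin.natAdd m i)) * θ) * ι (a i) *
        (ι (y (Fin.castAdd m i)) + ι (y (Fin.natAdd m i)) * θ) =
        ι (a i * y (Fin.castAdd m i) ^ 2 + -(t * a i) * y (Fin.natAdd m i) ^ 2) := by
      intro i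
      simp only [map_add, map_mul, map_neg, map_pow, hσι, hσθ]
      linear_combination (-(ι (a i)) * ι (y (Fin.natAdd m i)) ^ 2) * hθt
    simp only [hterm]
    rw [← map_sum, Finset.sum_add_distrib, hq, map_zero]

/-! ## §2 The number-field instance: `R = E ⊗_F F_v`, `σ = c ⊗ 1`, `θ = δ ⊗ 1` -/

section NumberField

variable {F : Type} (E : Type) [Field F] [NumberField F] [Field E] [NumberField E] [Algebra F E]

/-- **A diagonal hermitian form of rank `m ≥ 3` is isotropic over `E ⊗_F F_v` at every finite place `v`** — data
form: `c ∈ Aut(E/F)`, `δ ∈ E` with `c δ = -δ ≠ 0` and `δ² = t ∈ F`, coefficients `a₁, …, a_m ∈ F` (arbitrary); then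
`∃ x ∈ (E ⊗_F F_v)^m`, `x ≠ 0`, `Σᵢ (c ⊗ 1)(xᵢ) (aᵢ ⊗ 1) xᵢ = 0`.  (Trace form `⟨a⟩ ⊗ ⟨1, -t⟩` has rank `2m ≥ 5`,
hence a non-trivial zero over `F_v`, O'Meara 63:19 = tree `diagIsotropic_adicCompletion_of_five_le`; then §1.)
[cite: Jacobson1940HermitianForms, §3 (1)(a)] [cite: Omeara1963, §63C Prop. 63:19 p. 170] -/
theorem exists_isotropic_localRing_of_mul_self_eq (c : E ≃ₐ[F] E) {δ : E} (hcδ : c δ = -δ) (hδ : δ ≠ 0)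
    {t : F} (ht : δ * δ = algebraMap F E t) (v : HeightOneSpectrum (𝓞 F)) {m : ℕ} (hm : 3 ≤ m)
    (a : Fin m → F) :
    ∃ x : Fin m → UnitaryGroup.LocalRing E v, x ≠ 0 ∧
      ∑ i, UnitaryGroup.conjLocal E c v (x i) *
        algebraMap E (UnitaryGroup.LocalRing E v) (algebraMap F E (a i)) * x i = 0 := by
  set φ := algebraMap F (v.adicCompletion F) with hφ
  have h2 : (2 : v.adicCompletion F) ≠ 0 := by
    rw [← map_ofNat φ 2]; exact (map_ne_zero φ).2 two_ne_zero
  -- the data of §1 at `R = E ⊗ F_v`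
  have hιφ : ∀ x : F, UnitaryGroup.toLocalRing E v (φ x) =
      algebraMap E (UnitaryGroup.LocalRing E v) (algebraMap F E x) := fun x =>
    UnitaryGroup.toLocalRing_coe E v x
  obtain ⟨x, hx, hsum⟩ := exists_isotropic_of_diagIsotropic (UnitaryGroup.toLocalRing E v)
    (UnitaryGroup.toLocalRing_injective E v) (UnitaryGroup.conjLocal E c v)
    (UnitaryGroup.conjLocal_toLocalRing c v) (θ := algebraMap E (UnitaryGroup.LocalRing E v) δ)
    (by rw [UnitaryGroup.conjLocal_algebraMap, hcδ, map_neg]) ((IsUnit.mk0 δ hδ).map _)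
    (t := φ t) (by rw [← map_mul, ht, hιφ]) h2 (a := fun i => φ (a i))
    (diagIsotropic_adicCompletion_of_five_le F v (by omega) _)
  refine ⟨x, hx, ?_⟩
  simpa only [hιφ] using hsum

/-! ## §3 Parameter-free forms for a quadratic extension -/

omit [NumberField E] in
/-- In a quadratic extension `E/F` with `c ∈ Aut(E/F)`, `c ≠ 1`, there is `δ ∈ E` with `c δ = -δ ≠ 0`
(`δ = e - c e` for any `e` moved by `c`; `c² = 1`). [folklore] -/
private theorem exists_apply_eq_neg [Algebra.IsQuadraticExtension F E] (c : E ≃ₐ[F] E) (hc : c ≠ 1) :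
    ∃ δ : E, c δ = -δ ∧ δ ≠ 0 := by
  haveI : FiniteDimensional F E :=
    Module.finite_of_finrank_eq_succ (Algebra.IsQuadraticExtension.finrank_eq_two F E)
  haveI : PerfectField F := inferInstance
  haveI : Algebra.IsAlgebraic F E := inferInstance
  haveI : Algebra.IsSeparable F E := inferInstance
  obtain ⟨e, he⟩ : ∃ e : E, c e ≠ e := by
    by_contra h
    push Not at h
    exact hc (AlgEquiv.ext h)
  refine ⟨e - c e, ?_, sub_ne_zero.mpr (Ne.symm he)⟩
  rw [map_sub, neg_sub, ← AlgEquiv.mul_apply, algEquiv_mul_self_eq_one F hc, AlgEquiv.one_apply]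

/-- In a quadratic extension `E/F` with `c ≠ 1`, **the `c`-fixed elements are `F`-rational**: `c e = e ⟹ e ∈ F`
(`E = F ⊕ F δ` with `c δ = -δ`). [folklore] -/
private theorem exists_algebraMap_eq_of_apply_eq_self [Algebra.IsQuadraticExtension F E] (c : E ≃ₐ[F] E) (hc : c ≠ 1)
    {e : E} (he : c e = e) : ∃ x : F, algebraMap F E x = e := by
  obtain ⟨δ, hcδ, hδ⟩ := exists_apply_eq_neg E c hc
  obtain ⟨x, y, rfl⟩ := UnitaryGroup.exists_eq_add_mul_of_isQuadraticExtension E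
    (UnitaryGroup.not_mem_range_algebraMap_of_apply_eq_neg E c hcδ hδ) e
  rw [map_add, map_mul, AlgEquiv.commutes, AlgEquiv.commutes, hcδ] at he
  have hy : algebraMap F E y * δ + algebraMap F E y * δ = 0 := by linear_combination -he
  rw [add_self_eq_zero, mul_eq_zero, or_iff_left hδ, map_eq_zero] at hy
  exact ⟨x, by rw [hy, map_zero, zero_mul, add_zero]⟩

/-- `δ² ∈ F` for `c δ = -δ` in a quadratic extension. [folklore] -/
private theorem exists_mul_self_eq_algebraMap [Algebra.IsQuadraticExtension F E] (c : E ≃ₐ[F] E) (hc : c ≠ 1)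
    {δ : E} (hcδ : c δ = -δ) : ∃ t : F, δ * δ = algebraMap F E t := by
  obtain ⟨t, ht⟩ := exists_algebraMap_eq_of_apply_eq_self E c hc (e := δ * δ)
    (by rw [map_mul, hcδ, neg_mul_neg])
  exact ⟨t, ht.symm⟩

/-- **Every diagonal hermitian form of rank `m ≥ 3` over a quadratic extension `E/F` of number fields is isotropic
over `E ⊗_F F_v` at every finite place `v` of `F`.**  For `c ∈ Aut(E/F)`, `c ≠ 1`, and `d₁, …, d_m ∈ E` with
`c dᵢ = dᵢ` (arbitrary otherwise): `∃ x ∈ (E ⊗_F F_v)^m = (Π_{w ∣ v} E_w)^m`, `x ≠ 0`,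
`Σᵢ (c ⊗ 1)(xᵢ) (dᵢ ⊗ 1) xᵢ = 0`.  (At a split `v` this is the easy statement that `E_w × E_w` with the swap has
isotropic vectors; at a non-split `v`, where `E ⊗_F F_v = E_w` is a field, it is Jacobson's local theorem.)
[cite: Jacobson1940HermitianForms, §3 (1)(a)] [cite: Omeara1963, §63C Prop. 63:19 p. 170] -/
theorem exists_isotropic_localRing [Algebra.IsQuadraticExtension F E] (c : E ≃ₐ[F] E) (hc : c ≠ 1)
    (v : HeightOneSpectrum (𝓞 F)) {m : ℕ} (hm : 3 ≤ m) {d : Fin m → E} (hd : ∀ i, c (d i) = d i) :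
    ∃ x : Fin m → UnitaryGroup.LocalRing E v, x ≠ 0 ∧
      ∑ i, UnitaryGroup.conjLocal E c v (x i) * algebraMap E (UnitaryGroup.LocalRing E v) (d i) * x i = 0 := by
  obtain ⟨δ, hcδ, hδ⟩ := exists_apply_eq_neg E c hc
  obtain ⟨t, ht⟩ := exists_mul_self_eq_algebraMap E c hc hcδ
  choose a ha using fun i => exists_algebraMap_eq_of_apply_eq_self E c hc (hd i)
  obtain ⟨x, hx, hsum⟩ := exists_isotropic_localRing_of_mul_self_eq E c hcδ hδ ht v hm a
  exact ⟨x, hx, by simpa only [ha] using hsum⟩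

/-- Matrix dress of `exists_isotropic_localRing`: for `J = Matrix.diagonal d` read in `E ⊗_F F_v`,
`ᵗ(c ⊗ 1)(x) · J · x = 0` for some `x ≠ 0`, i.e. `((c ⊗ 1) ∘ x) ⬝ᵥ (J *ᵥ x) = 0`.
[cite: Jacobson1940HermitianForms, §3 (1)(a)] -/
theorem exists_isotropic_localRing_diagonal [Algebra.IsQuadraticExtension F E] (c : E ≃ₐ[F] E) (hc : c ≠ 1)
    (v : HeightOneSpectrum (𝓞 F)) {m : ℕ} (hm : 3 ≤ m) {d : Fin m → E} (hd : ∀ i, c (d i) = d i) :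
    ∃ x : Fin m → UnitaryGroup.LocalRing E v, x ≠ 0 ∧
      dotProduct (fun i => UnitaryGroup.conjLocal E c v (x i))
        (((Matrix.diagonal d).map (algebraMap E (UnitaryGroup.LocalRing E v))).mulVec x) = 0 := by
  obtain ⟨x, hx, hsum⟩ := exists_isotropic_localRing E c hc v hm hd
  refine ⟨x, hx, ?_⟩
  rw [Matrix.diagonal_map (map_zero _)]
  simpa only [dotProduct, Matrix.mulVec_diagonal, mul_assoc] using hsum

omit [NumberField F] in
/-- The local form `J ⊗ 1 ∈ M_N(E ⊗_F F_v)` of the adelic unitary group `U(J)` (tree `UnitaryGroup.adelicForm`,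
read at `v` by `UnitaryGroup.adeleToLocal`) is `J` pushed along `E → E ⊗_F F_v`. [folklore] -/
private theorem adelicForm_map_adeleToLocal {N : ℕ} (J : Matrix (Fin N) (Fin N) E)
    (v : HeightOneSpectrum (𝓞 F)) :
    (UnitaryGroup.adelicForm E N J).map (UnitaryGroup.adeleToLocal E v) =
      J.map (algebraMap E (UnitaryGroup.LocalRing E v)) := by
  rw [UnitaryGroup.adelicForm, Matrix.map_map]
  rfl

/-- `exists_isotropic_localRing` for the LOCAL FORM of `U(diag d)` at `v` — the matrix
`(adelicForm E m (diagonal d)).map (adeleToLocal E v)` defining the tree's local group `UnitaryGroup.«local» … v`: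
it has an isotropic vector in `(E ⊗_F F_v)^m`. [cite: Jacobson1940HermitianForms, §3 (1)(a)] -/
theorem exists_isotropic_localRing_adelicForm [Algebra.IsQuadraticExtension F E] (c : E ≃ₐ[F] E) (hc : c ≠ 1)
    (v : HeightOneSpectrum (𝓞 F)) {m : ℕ} (hm : 3 ≤ m) {d : Fin m → E} (hd : ∀ i, c (d i) = d i) :
    ∃ x : Fin m → UnitaryGroup.LocalRing E v, x ≠ 0 ∧
      dotProduct (fun i => UnitaryGroup.conjLocal E c v (x i))
        (((UnitaryGroup.adelicForm E m (Matrix.diagonal d)).map (UnitaryGroup.adeleToLocal E v)).mulVec x) = 0 := by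
  rw [adelicForm_map_adeleToLocal]
  exact exists_isotropic_localRing_diagonal E c hc v hm hd

/-- **Single-completion form at a NON-SPLIT place.**  `E/F` quadratic with `c ≠ 1`, `w` a finite place of `E`
FIXED by `c` (`c • w = w`: the place `v` of `F` below `w` is inert or ramified, `E ⊗_F F_v = E_w` a field), with
the induced conjugation `c_w = galAdicCompletionMap c hw` of `E_w`, and `d₁, …, d_m ∈ E` (`m ≥ 3`) with `c dᵢ = dᵢ`:
the hermitian form `⟨d⟩` is isotropic over `E_w` — `∃ x ∈ E_w^m`, `x ≠ 0`, `Σᵢ c_w(xᵢ) dᵢ xᵢ = 0`.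
(§1 with `R = E_w`, `ι = ι_w : F_v →+* E_w` = `UnitaryGroup.toPlace`, `σ = c_w`, which fixes `ι_w(F_v)` by
`galAdicCompletionMap_toPlace`.) [cite: Jacobson1940HermitianForms, §3 (1)(a)]
[cite: Omeara1963, §63C Prop. 63:19 p. 170] -/
theorem exists_isotropic_adicCompletion [Algebra.IsQuadraticExtension F E] (c : E ≃ₐ[F] E) (hc : c ≠ 1)
    {w : HeightOneSpectrum (𝓞 E)} (hw : c • w = w) {m : ℕ} (hm : 3 ≤ m) {d : Fin m → E}
    (hd : ∀ i, c (d i) = d i) :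
    ∃ x : Fin m → w.adicCompletion E, x ≠ 0 ∧
      ∑ i, galAdicCompletionMap c hw (x i) * algebraMap E (w.adicCompletion E) (d i) * x i = 0 := by
  obtain ⟨δ, hcδ, hδ⟩ := exists_apply_eq_neg E c hc
  obtain ⟨t, ht⟩ := exists_mul_self_eq_algebraMap E c hc hcδ
  choose a ha using fun i => exists_algebraMap_eq_of_apply_eq_self E c hc (hd i)
  -- the place below and the structure map `ι_w : F_v →+* E_w`
  set v : HeightOneSpectrum (𝓞 F) := w.under (𝓞 F) with hv
  let w' : UnitaryGroup.PlacesOver E v := ⟨w, rfl⟩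
  set φ := algebraMap F (v.adicCompletion F) with hφ
  set ι := UnitaryGroup.toPlace v w' with hιdef
  have h2 : (2 : v.adicCompletion F) ≠ 0 := by
    rw [← map_ofNat φ 2]; exact (map_ne_zero φ).2 two_ne_zero
  have hcoe : ∀ e : E, ((e : E) : w.adicCompletion E) = algebraMap E (w.adicCompletion E) e := fun e => rfl
  have hιφ : ∀ x : F, ι (φ x) = algebraMap E (w.adicCompletion E) (algebraMap F E x) := fun x =>
    (UnitaryGroup.toPlace_coe v w' x).trans (hcoe _)
  obtain ⟨x, hx, hsum⟩ := exists_isotropic_of_diagIsotropic ι ι.injective (galAdicCompletionMap c hw)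
    (fun s => UnitaryGroup.galAdicCompletionMap_toPlace c w' w' hw s) (θ := ((δ : E) : w.adicCompletion E))
    (by rw [galAdicCompletionMap_coe_algEquiv, hcδ, hcoe, hcoe, map_neg])
    (by rw [hcoe]; exact (IsUnit.mk0 δ hδ).map _)
    (t := φ t) (by rw [hcoe, ← map_mul, ht, hιφ]) h2 (a := fun i => φ (a i))
    (diagIsotropic_adicCompletion_of_five_le F v (by omega) _)
  refine ⟨x, hx, ?_⟩
  simpa only [hιφ, ha] using hsum

/-- Matrix dress of `exists_isotropic_adicCompletion`: the tree's
`UnitaryGroup.placeForm (diagonal d) w = (diagonal d) ⊗ 1 ∈ M_m(E_w)` has an isotropic vector,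
`(c_w ∘ x) ⬝ᵥ (J_w *ᵥ x) = 0`, `x ≠ 0`. [cite: Jacobson1940HermitianForms, §3 (1)(a)] -/
theorem exists_isotropic_adicCompletion_placeForm [Algebra.IsQuadraticExtension F E] (c : E ≃ₐ[F] E)
    (hc : c ≠ 1) {w : HeightOneSpectrum (𝓞 E)} (hw : c • w = w) {m : ℕ} (hm : 3 ≤ m) {d : Fin m → E}
    (hd : ∀ i, c (d i) = d i) :
    ∃ x : Fin m → w.adicCompletion E, x ≠ 0 ∧
      dotProduct (fun i => galAdicCompletionMap c hw (x i))
        ((UnitaryGroup.placeForm (Matrix.diagonal d) w).mulVec x) = 0 := by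
  obtain ⟨x, hx, hsum⟩ := exists_isotropic_adicCompletion E c hc hw hm hd
  refine ⟨x, hx, ?_⟩
  rw [UnitaryGroup.placeForm, Matrix.diagonal_map (map_zero _)]
  simpa only [dotProduct, Matrix.mulVec_diagonal, mul_assoc] using hsum

/-- **CM form.** `L` a CM field, `L⁺` its maximal totally real subfield, `c` = complex conjugation, `v` a finite
place of `L⁺`, `d₁, …, d_m ∈ L` (`m ≥ 3`) with `d̄ᵢ = dᵢ`: the hermitian form `⟨d₁, …, d_m⟩` is isotropic over
`L ⊗_{L⁺} L⁺_v`. [cite: Jacobson1940HermitianForms, §3 (1)(a)] [cite: Omeara1963, §63C Prop. 63:19 p. 170] -/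
theorem exists_isotropic_localRing_cm (L : Type) [Field L] [NumberField L] [IsCMField L]
    (v : HeightOneSpectrum (𝓞 ↥(maximalRealSubfield L))) {m : ℕ} (hm : 3 ≤ m) {d : Fin m → L}
    (hd : ∀ i, IsCMField.complexConj L (d i) = d i) :
    ∃ x : Fin m → UnitaryGroup.LocalRing L v, x ≠ 0 ∧
      ∑ i, UnitaryGroup.conjLocal L (IsCMField.complexConj L) v (x i) *
        algebraMap L (UnitaryGroup.LocalRing L v) (d i) * x i = 0 :=
  exists_isotropic_localRing L (IsCMField.complexConj L) (IsCMField.complexConj_ne_one L) v hm hd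

end NumberField

end HermitianLocal

end Literature.NumberTheory.QuadraticForms
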